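import Summits.CriticalPhenomena.PercolationContinuityZ3.Theorems.PercNearOneGluingNoHeavyLowerTailSahiLatinSections
import Summits.CriticalPhenomena.PercolationContinuityZ3.Theorems.PercNearOneGluingNoHeavyLowerTailSahiLatinPairClosure

/-!
# `NoHeavyLowerTail` (crux stmt-CriticalPhenomena-4575), Sahi programme (prim-master-conj gen 45): THE ONE-AXIS CYLINDER PARTNER —
# exact letter expansion of `κ(a, b, {x_i ≥ 1})`, its slack decomposition and zero structure, and CONJECTURE TZ″ / TZ′ / TZ for every
# pair with a cylinder partner / every A-closed or terminal zero with a cylinder member (all dimensions, FBP-free)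

Support file (`--supports stmt-CriticalPhenomena-4575`).  Memos `run/shared/lean/prim/prim-l12/FROM-prim-master-conj-g44-SLACK-CALCULUS.md` §6–§7
and gen 45; POINTWISE §45–§46.  Vocabulary of `…SahiLatin{Kernel,Functionals,Slack,Indep,Descent,TerminalSupport,PairClosure,Sections}`.

THE MATHEMATICS (axis `none` of the index type `Option κ`, `d' = |κ|`, sections `x_l = sec x l ⊆ [3]^κ`).
* `cyl1 = {x : x none ≠ 0}` (the threshold-1 cylinder `{x_none ≥ 1}`), `cyl2 = {x : x none = 2}`.
* **`kappa_cyl1`** (EXACT, arbitrary finsets `a, b`): `κ(a,b,cyl1) = 3·S1(a₁∩b₁) + 3·S1(a₂∩b₂) − 2·S1(a₀∩b₀) − 2·L(a₁,b₂) − 2·L(a₂,b₁)`,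
  from the letter expansion `kappa_option`; **`kappa_cyl1_card`**: `= 2^{d'}(3|a₁b₁| + 3|a₂b₂| − 2|a₀b₀| − 2|a₁b₂| − 2|a₂b₁|) + 2·HS(a₁,b₂) + 2·HS(a₂,b₁)`.
* **`kappa_cyl1_nonneg`** (up-sets): the bracket is `(|a₂b₂|−|a₁b₂|) + (|a₂b₂|−|a₂b₁|) + (|a₂b₂|+|a₁b₁|−|a₁b₂|−|a₂b₁|) + 2(|a₁b₁|−|a₀b₀|) ≥ 0`
  (nested sections; the third term is the modular corner `card_corner_le`) and the slacks are `≥ 0` (coefficientwise Harris) — so this face of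
  FBP holds with an explicit five-term decomposition.  (Positivity of a principal first slot in every dimension is already the Sahi cell's
  `SahiGridPattern.sStarD_principal_nonneg` / `sStarD_principal_ge_harris`; new here are the exact formula and its equality structure.)
* **`sections_of_kappa_cyl1_eq_zero`**: at a zero, `a₂∩b₂ = a₂∩b₁ = a₁∩b₂`, `a₁∩b₁ = a₀∩b₀`, `a₁ ⊥ b₂`, `a₂ ⊥ b₁`.
* **`kappa_cyl1_ne_zero_of_mutAClosed`** / `…_pos_…` (TZ″ FOR A CYLINDER PARTNER): if the up-set `b` depends on the axis `none`, `(b, cyl1)` is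
  mutually A-closed and `a` is a nonempty up-set, then `κ(a,b,cyl1) > 0`.  Proof: mutual A-closedness gives `⊤' ∈ b₀ = b₁` (`top_mem_sec_zero`,
  `sec_zero_eq_sec_one`), dependence a point `y' ∈ b₂ ∖ b₁`; at a zero, raising the `b₁`-inessential coordinates of `y'` to `2` produces a point
  of `a₂ ∩ (b₂ ∖ b₁) = ∅`.  The `cyl2` partner is VACUOUS: `indep_cyl2_of_mutAClosed` (mutual A-closedness forces `b₀ = b₁ = b₂`).
  Hence **`mutAClosedZeroFree_cyl1`**, **`mutAClosedZeroFree_cyl2`**: conjecture `MutAClosedZeroFree` (`…SahiLatinPairClosure`) holds for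
  every pair with a one-axis cylinder partner.
* **`indep_all_of_aclosed_zero_cyl1`** (`₁`, `₂` for the other slots), **`indep_all_of_aclosed_zero_cyl2`**, **`indep_all_of_terminal_zero_cyl1`**:
  conjectures TZ′ (`AClosedZerosIndep`) and TZ (`TerminalZerosIndep`) hold for every triple with a one-axis cylinder member — such A-closed /
  terminal zeros are pairwise independent — in every dimension, without any positivity hypothesis.
Other axes: relabel the index type so that the cylinder axis is `none` (`ι ≃ Option {j // j ≠ i}`); not spelled out here.
HONEST LABEL: TZ, TZ′, TZ″ in general and FBP(3,d) for `d ≥ 5` remain OPEN; nothing here asserts them or the crux. [this work]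
-/

namespace Summit.CriticalPhenomena.PercolationContinuityZ3.Theorems.SahiLatin

open Finset

variable {κ : Type*} [Fintype κ] [DecidableEq κ]

/-! ## §1  The one-axis cylinders -/
/-- The threshold-1 CYLINDER on the axis `none`: `{x : x none ≠ 0}` (`= {x_none ≥ 1}`). [this work] -/
def cyl1 : Finset (Pt (Option κ)) := univ.filter fun x => x none ≠ 0

/-- The threshold-2 CYLINDER on the axis `none`: `{x : x none = 2}`. [this work] -/
def cyl2 : Finset (Pt (Option κ)) := univ.filter fun x => x none = 2

/-- Membership in `cyl1`. [this work] -/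
@[simp] theorem mem_cyl1 {x : Pt (Option κ)} : x ∈ (cyl1 : Finset (Pt (Option κ))) ↔ x none ≠ 0 := by simp [cyl1]
/-- Membership in `cyl2`. [this work] -/
@[simp] theorem mem_cyl2 {x : Pt (Option κ)} : x ∈ (cyl2 : Finset (Pt (Option κ))) ↔ x none = 2 := by simp [cyl2]

/-- Order facts in `Fin 3` (finite checks). [this work] -/
theorem fin3_facts : (∀ u v : Fin 3, u ≠ 0 → u ≤ v → v ≠ 0) ∧ (∀ u v : Fin 3, u = 2 → u ≤ v → v = 2) ∧
    (∀ u : Fin 3, u ≠ 0 → 1 ≤ u) ∧ (∀ v : Fin 3, (2 : Fin 3) ≤ v → v = 2) := by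
  refine ⟨by decide, by decide, by decide, by decide⟩

/-- `cyl1` is an up-set. [this work] -/
theorem isUpperSet_cyl1 : IsUpperSet ((cyl1 : Finset (Pt (Option κ))) : Set (Pt (Option κ))) := by
  intro x y hxy hx
  rw [Finset.mem_coe, mem_cyl1] at hx ⊢
  exact fin3_facts.1 _ _ hx (hxy none)
/-- `cyl2` is an up-set. [this work] -/
theorem isUpperSet_cyl2 : IsUpperSet ((cyl2 : Finset (Pt (Option κ))) : Set (Pt (Option κ))) := by
  intro x y hxy hx
  rw [Finset.mem_coe, mem_cyl2] at hx ⊢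
  exact fin3_facts.2.1 _ _ hx (hxy none)

/-- Sections of `cyl1`: empty at level `0`. [this work] -/
@[simp] theorem sec_cyl1_zero : sec (cyl1 : Finset (Pt (Option κ))) 0 = ∅ := by ext x'; simp
/-- Sections of `cyl1`: full at level `1`. [this work] -/
@[simp] theorem sec_cyl1_one : sec (cyl1 : Finset (Pt (Option κ))) 1 = univ := by ext x'; simp
/-- Sections of `cyl1`: full at level `2`. [this work] -/
@[simp] theorem sec_cyl1_two : sec (cyl1 : Finset (Pt (Option κ))) 2 = univ := by ext x'; simp

/-- `cyl1` is inessential on every axis `some k`. [this work] -/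
theorem axisInessential_cyl1_some (k : κ) : AxisInessential (cyl1 : Finset (Pt (Option κ))) (some k) := by
  intro x v; simp [Function.update_of_ne]
/-- `cyl2` is inessential on every axis `some k`. [this work] -/
theorem axisInessential_cyl2_some (k : κ) : AxisInessential (cyl2 : Finset (Pt (Option κ))) (some k) := by
  intro x v; simp [Function.update_of_ne]

/-- A set inessential on the axis `none` is independent of `cyl1`. [this work] -/
theorem indep_cyl1_of_axisInessential {b : Finset (Pt (Option κ))} (h : AxisInessential b none) : Indep b cyl1 :=
  fun i => i.casesOn (Or.inl h) fun k => Or.inr (axisInessential_cyl1_some k)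

/-- A set inessential on the axis `none` is independent of `cyl2`. [this work] -/
theorem indep_cyl2_of_axisInessential {b : Finset (Pt (Option κ))} (h : AxisInessential b none) : Indep b cyl2 :=
  fun i => i.casesOn (Or.inl h) fun k => Or.inr (axisInessential_cyl2_some k)

/-! ## §2  Elementary values of the Latin functionals -/

/-- `S1 ∅ = 0`. [this work] -/
@[simp] theorem S1_empty : S1 (∅ : Finset (Pt κ)) = 0 := by simp [S1]
/-- `latinPairs ∅ t = 0`. [this work] -/
@[simp] theorem latinPairs_empty_left (t : Finset (Pt κ)) : latinPairs ∅ t = 0 := by simp [latinPairs]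
/-- `latinPairs s ∅ = 0`. [this work] -/
@[simp] theorem latinPairs_empty_right (s : Finset (Pt κ)) : latinPairs s ∅ = 0 := by simp [latinPairs]
/-- `latinPairs univ t = S1 t`. [this work] -/
@[simp] theorem latinPairs_univ_left (t : Finset (Pt κ)) : latinPairs univ t = S1 t := by
  rw [← sum_ind_one t, latinPairs]
  exact sum_congr rfl fun ρ _ => by simp [ind]

/-- `latinPairs s univ = S1 s`. [this work] -/
@[simp] theorem latinPairs_univ_right (s : Finset (Pt κ)) : latinPairs s univ = S1 s := by
  rw [latinPairs_comm, latinPairs_univ_left]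

/-- `latinTriples s t ∅ = 0`. [this work] -/
@[simp] theorem latinTriples_empty_third (s t : Finset (Pt κ)) : latinTriples s t ∅ = 0 := by simp [latinTriples]
/-- `latinTriples s t univ = latinPairs s t`. [this work] -/
@[simp] theorem latinTriples_univ_third (s t : Finset (Pt κ)) : latinTriples s t univ = latinPairs s t := by
  rw [latinTriples, latinPairs]
  exact sum_congr rfl fun ρ _ => by simp [ind]

/-! ## §3  The letter expansion of `κ` for the threshold-1 cylinder partner -/

/-- **THE CYLINDER FORMULA** (all `κ`, arbitrary finsets `a, b`; `x_l = sec x l`, functionals in dimension `κ`):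
`κ(a, b, {x_none ≥ 1}) = 3·S1(a₁∩b₁) + 3·S1(a₂∩b₂) − 2·S1(a₀∩b₀) − 2·L(a₁,b₂) − 2·L(a₂,b₁)`. [this work] -/
theorem kappa_cyl1 (a b : Finset (Pt (Option κ))) :
    kappa a b cyl1 = 3 * S1 (sec a 1 ∩ sec b 1) + 3 * S1 (sec a 2 ∩ sec b 2) - 2 * S1 (sec a 0 ∩ sec b 0)
      - 2 * latinPairs (sec a 1) (sec b 2) - 2 * latinPairs (sec a 2) (sec b 1) := by
  rw [kappa_option, sum_perm3 (fun i j k => 2 * S1 (sec a i ∩ sec b i ∩ sec cyl1 i)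
        - latinPairs (sec a i) (sec b j ∩ sec cyl1 j) - latinPairs (sec b i) (sec a j ∩ sec cyl1 j)
        - latinPairs (sec cyl1 i) (sec a j ∩ sec b j) + latinTriples (sec a i) (sec b j) (sec cyl1 k))]
  simp only [sec_cyl1_zero, sec_cyl1_one, sec_cyl1_two, inter_empty, inter_univ, S1_empty, latinPairs_empty_left,
    latinPairs_empty_right, latinPairs_univ_left, latinTriples_empty_third, latinTriples_univ_third, mul_zero]
  rw [latinPairs_comm (sec b 0) (sec a 1), latinPairs_comm (sec b 0) (sec a 2), latinPairs_comm (sec b 1) (sec a 2),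
    latinPairs_comm (sec b 2) (sec a 1), ← sum_ind_one (sec a 0 ∩ sec b 0), ← sum_ind_one (sec a 1 ∩ sec b 1),
    ← sum_ind_one (sec a 2 ∩ sec b 2)]
  rw [show (∑ σ : LPerm κ, ind (sec a 0 ∩ sec b 0) (lpt σ 1)) = latinPairs univ (sec a 0 ∩ sec b 0) from by
      rw [latinPairs_univ_left, sum_ind_one],
    show (∑ σ : LPerm κ, ind (sec a 1 ∩ sec b 1) (lpt σ 1)) = latinPairs univ (sec a 1 ∩ sec b 1) from by
      rw [latinPairs_univ_left, sum_ind_one],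
    show (∑ σ : LPerm κ, ind (sec a 2 ∩ sec b 2) (lpt σ 1)) = latinPairs univ (sec a 2 ∩ sec b 2) from by
      rw [latinPairs_univ_left, sum_ind_one]]
  simp only [latinPairs_univ_left]
  ring

/-- The cylinder formula in CARDINALITY / HARRIS-SLACK form (`d' = |κ|`):
`κ(a,b,{x_none ≥ 1}) = 2^{d'}·(3|a₁∩b₁| + 3|a₂∩b₂| − 2|a₀∩b₀| − 2|a₁∩b₂| − 2|a₂∩b₁|) + 2·HS(a₁,b₂) + 2·HS(a₂,b₁)`. [this work] -/
theorem kappa_cyl1_card (a b : Finset (Pt (Option κ))) :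
    kappa a b cyl1 = 2 ^ Fintype.card κ * (3 * ((sec a 1 ∩ sec b 1).card : ℤ) + 3 * (sec a 2 ∩ sec b 2).card
        - 2 * (sec a 0 ∩ sec b 0).card - 2 * (sec a 1 ∩ sec b 2).card - 2 * (sec a 2 ∩ sec b 1).card)
      + 2 * HS (sec a 1) (sec b 2) + 2 * HS (sec a 2) (sec b 1) := by
  rw [kappa_cyl1, S1_eq, S1_eq, S1_eq, HS_eq, HS_eq]
  ring

omit [DecidableEq κ] in
/-- The modular corner inequality for nested pairs: `a₁ ⊆ a₂`, `b₁ ⊆ b₂` ⟹ `|a₁∩b₂| + |a₂∩b₁| ≤ |a₂∩b₂| + |a₁∩b₁|`. [this work] -/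
theorem card_corner_le {a₁ a₂ b₁ b₂ : Finset (Pt κ)} (ha : a₁ ⊆ a₂) (hb : b₁ ⊆ b₂) :
    ((a₁ ∩ b₂).card : ℤ) + (a₂ ∩ b₁).card ≤ (a₂ ∩ b₂).card + (a₁ ∩ b₁).card := by
  have h1 : (a₁ ∩ b₂) ∪ (a₂ ∩ b₁) ⊆ a₂ ∩ b₂ := by
    intro x hx
    rw [mem_union, mem_inter, mem_inter] at hx
    rw [mem_inter]
    rcases hx with ⟨h1, h2⟩ | ⟨h1, h2⟩
    · exact ⟨ha h1, h2⟩
    · exact ⟨h1, hb h2⟩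
  have h2 : (a₁ ∩ b₂) ∩ (a₂ ∩ b₁) = a₁ ∩ b₁ := by
    ext x; simp only [mem_inter]
    constructor
    · rintro ⟨⟨h1, _⟩, _, h4⟩; exact ⟨h1, h4⟩
    · rintro ⟨h1, h4⟩; exact ⟨⟨h1, hb h4⟩, ha h1, h4⟩
  have h3 := card_union_add_card_inter (a₁ ∩ b₂) (a₂ ∩ b₁)
  rw [h2] at h3
  have : ((a₁ ∩ b₂).card : ℤ) + (a₂ ∩ b₁).card = ((a₁ ∩ b₂) ∪ (a₂ ∩ b₁)).card + (a₁ ∩ b₁).card := by exact_mod_cast h3.symm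
  have h4' : ((((a₁ ∩ b₂) ∪ (a₂ ∩ b₁)).card : ℕ) : ℤ) ≤ (a₂ ∩ b₂).card := by exact_mod_cast card_le_card h1
  linarith

/-- **The cylinder face of FBP, with its slack structure**: for up-sets `a, b`, `κ(a,b,{x_none ≥ 1})` is a sum of five nonnegative terms
(three section-cardinality differences, the modular corner term, and two Harris slacks).  (Positivity of a principal slot is the Sahi cell's
`SahiGridPattern.sStarD_principal_nonneg`; the point here is the exact decomposition.) [this work] -/
theorem kappa_cyl1_nonneg {a b : Finset (Pt (Option κ))} (ha : IsUpperSet (a : Set (Pt (Option κ))))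
    (hb : IsUpperSet (b : Set (Pt (Option κ)))) : 0 ≤ kappa a b cyl1 := by
  rw [kappa_cyl1_card]
  have h01 : (1 : Fin 3) ≤ 2 := by decide
  have h00 : (0 : Fin 3) ≤ 1 := by decide
  have c1 : ((sec a 1 ∩ sec b 2).card : ℤ) ≤ (sec a 2 ∩ sec b 2).card := by
    exact_mod_cast card_le_card (inter_subset_inter (sec_mono ha h01) subset_rfl)
  have c2 : ((sec a 2 ∩ sec b 1).card : ℤ) ≤ (sec a 2 ∩ sec b 2).card := by
    exact_mod_cast card_le_card (inter_subset_inter subset_rfl (sec_mono hb h01))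
  have c3 : ((sec a 0 ∩ sec b 0).card : ℤ) ≤ (sec a 1 ∩ sec b 1).card := by
    exact_mod_cast card_le_card (inter_subset_inter (sec_mono ha h00) (sec_mono hb h00))
  have c4 := card_corner_le (sec_mono ha h01) (sec_mono hb h01)
  have hs1 := HS_nonneg (isUpperSet_sec ha 1) (isUpperSet_sec hb 2)
  have hs2 := HS_nonneg (isUpperSet_sec ha 2) (isUpperSet_sec hb 1)
  have hp : (0 : ℤ) < 2 ^ Fintype.card κ := by positivity
  nlinarith

/-- **Zero structure on the cylinder face**: for up-sets `a, b`, `κ(a,b,{x_none ≥ 1}) = 0` forces `a₂∩b₂ = a₂∩b₁ = a₁∩b₂`, `a₁∩b₁ = a₀∩b₀`,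
`a₁ ⊥ b₂` and `a₂ ⊥ b₁` (sections, independence in dimension `κ`). [this work] -/
theorem sections_of_kappa_cyl1_eq_zero {a b : Finset (Pt (Option κ))} (ha : IsUpperSet (a : Set (Pt (Option κ))))
    (hb : IsUpperSet (b : Set (Pt (Option κ)))) (h0 : kappa a b cyl1 = 0) :
    sec a 2 ∩ sec b 2 = sec a 2 ∩ sec b 1 ∧ sec a 2 ∩ sec b 2 = sec a 1 ∩ sec b 2 ∧ sec a 1 ∩ sec b 1 = sec a 0 ∩ sec b 0 ∧
      Indep (sec a 1) (sec b 2) ∧ Indep (sec a 2) (sec b 1) := by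
  rw [kappa_cyl1_card] at h0
  have h01 : (1 : Fin 3) ≤ 2 := by decide
  have h00 : (0 : Fin 3) ≤ 1 := by decide
  have s1 : sec a 1 ∩ sec b 2 ⊆ sec a 2 ∩ sec b 2 := inter_subset_inter (sec_mono ha h01) subset_rfl
  have s2 : sec a 2 ∩ sec b 1 ⊆ sec a 2 ∩ sec b 2 := inter_subset_inter subset_rfl (sec_mono hb h01)
  have s3 : sec a 0 ∩ sec b 0 ⊆ sec a 1 ∩ sec b 1 := inter_subset_inter (sec_mono ha h00) (sec_mono hb h00)
  have c1 : ((sec a 1 ∩ sec b 2).card : ℤ) ≤ (sec a 2 ∩ sec b 2).card := by exact_mod_cast card_le_card s1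
  have c2 : ((sec a 2 ∩ sec b 1).card : ℤ) ≤ (sec a 2 ∩ sec b 2).card := by exact_mod_cast card_le_card s2
  have c3 : ((sec a 0 ∩ sec b 0).card : ℤ) ≤ (sec a 1 ∩ sec b 1).card := by exact_mod_cast card_le_card s3
  have c4 := card_corner_le (sec_mono ha h01) (sec_mono hb h01)
  have hs1 := HS_nonneg (isUpperSet_sec ha 1) (isUpperSet_sec hb 2)
  have hs2 := HS_nonneg (isUpperSet_sec ha 2) (isUpperSet_sec hb 1)
  have hp : (0 : ℤ) < 2 ^ Fintype.card κ := by positivity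
  have hbr : (0 : ℤ) ≤ 3 * ((sec a 1 ∩ sec b 1).card : ℤ) + 3 * (sec a 2 ∩ sec b 2).card - 2 * (sec a 0 ∩ sec b 0).card
      - 2 * (sec a 1 ∩ sec b 2).card - 2 * (sec a 2 ∩ sec b 1).card := by linarith
  have hbr0 : 3 * ((sec a 1 ∩ sec b 1).card : ℤ) + 3 * (sec a 2 ∩ sec b 2).card - 2 * (sec a 0 ∩ sec b 0).card
      - 2 * (sec a 1 ∩ sec b 2).card - 2 * (sec a 2 ∩ sec b 1).card = 0 := by nlinarith
  have e1 : ((sec a 1 ∩ sec b 2).card : ℤ) = (sec a 2 ∩ sec b 2).card := by linarith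
  have e2 : ((sec a 2 ∩ sec b 1).card : ℤ) = (sec a 2 ∩ sec b 2).card := by linarith
  have e3 : ((sec a 0 ∩ sec b 0).card : ℤ) = (sec a 1 ∩ sec b 1).card := by linarith
  have eH1 : HS (sec a 1) (sec b 2) = 0 := by nlinarith
  have eH2 : HS (sec a 2) (sec b 1) = 0 := by nlinarith
  refine ⟨(eq_of_subset_of_card_le s2 (by exact_mod_cast e2.symm.le)).symm,
    (eq_of_subset_of_card_le s1 (by exact_mod_cast e1.symm.le)).symm,
    (eq_of_subset_of_card_le s3 (by exact_mod_cast e3.symm.le)).symm, ?_, ?_⟩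
  · exact (HS_eq_zero_iff_indep (isUpperSet_sec ha 1) (isUpperSet_sec hb 2)).1 eH1
  · exact (HS_eq_zero_iff_indep (isUpperSet_sec ha 2) (isUpperSet_sec hb 1)).1 eH2

/-! ## §4  Mutually A-closed pairs with a cylinder partner -/

omit [Fintype κ] [DecidableEq κ] in
/-- Gluing level `2` to the top point of `[3]^κ` gives the top point. [this work] -/
theorem glue_two_top : glue (2 : Fin 3) (fun _ : κ => (2 : Fin 3)) = fun _ => (2 : Fin 3) := by
  funext o; cases o <;> rfl

/-- The unique maximal non-element of `cyl1` is `glue 0 ⊤'`. [this work] -/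
theorem isMaxOut_cyl1_glue_zero_top : IsMaxOut (cyl1 : Finset (Pt (Option κ))) (glue 0 fun _ => 2) := by
  refine ⟨by simp, fun y hy hne => ?_⟩
  rw [mem_cyl1]
  intro h0
  apply hne
  funext o
  cases o with
  | none => simpa using h0
  | some k =>
    have := hy (some k)
    simp only [glue_some] at this
    exact fin3_facts.2.2.2 _ this

/-- If every maximal non-element of `cyl1` lies in `b`, then `⊤' ∈ b₀`. [this work] -/
theorem top_mem_sec_zero {b : Finset (Pt (Option κ))} (h : ∀ m, IsMaxOut (cyl1 : Finset (Pt (Option κ))) m → m ∈ b) :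
    (fun _ : κ => (2 : Fin 3)) ∈ sec b 0 :=
  mem_sec.2 (h _ isMaxOut_cyl1_glue_zero_top)

/-- If every maximal non-element of the up-set `b` lies in `cyl1` (none at level `0`), then `b₀ = b₁`. [this work] -/
theorem sec_zero_eq_sec_one {b : Finset (Pt (Option κ))} (hb : IsUpperSet (b : Set (Pt (Option κ))))
    (h : ∀ m, IsMaxOut b m → m ∈ (cyl1 : Finset (Pt (Option κ)))) : sec b 0 = sec b 1 := by
  refine Subset.antisymm (sec_mono hb (by decide)) fun x' hx => ?_
  rw [mem_sec] at hx ⊢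
  by_contra h0
  obtain ⟨m, hm, hxm⟩ := exists_isMaxOut_ge h0
  have hmc : m none ≠ 0 := mem_cyl1.1 (h m hm)
  have hle : glue 1 x' ≤ m := by
    intro o
    cases o with
    | none => simpa using fin3_facts.2.2.1 _ hmc
    | some k => simpa using hxm (some k)
  exact hm.1 (hb hle hx)

/-- If every maximal non-element of the up-set `b` lies in `cyl2` (all at level `2`), then all three sections of `b` coincide with `b₂`.
[this work] -/
theorem sec_eq_sec_two_of_cyl2 {b : Finset (Pt (Option κ))} (hb : IsUpperSet (b : Set (Pt (Option κ))))
    (h : ∀ m, IsMaxOut b m → m ∈ (cyl2 : Finset (Pt (Option κ)))) (l : Fin 3) : sec b l = sec b 2 := by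
  refine Subset.antisymm (sec_mono hb (Fin.le_iff_val_le_val.2 (by have := l.isLt; simp; omega))) fun x' hx => ?_
  rw [mem_sec] at hx ⊢
  by_contra h0
  obtain ⟨m, hm, hxm⟩ := exists_isMaxOut_ge h0
  have hmc : m none = 2 := mem_cyl2.1 (h m hm)
  have hle : glue 2 x' ≤ m := by
    intro o
    cases o with
    | none => simp [hmc]
    | some k => simpa using hxm (some k)
  exact hm.1 (hb hle hx)

/-- If all three sections of `b` agree, `b` is inessential on the axis `none`. [this work] -/
theorem axisInessential_none_of_sec_eq {b : Finset (Pt (Option κ))} (h : ∀ l, sec b l = sec b 2) : AxisInessential b none := by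
  intro x v
  have hx : x = glue (x none) (fun k => x (some k)) := (glue_eta x).symm
  have hu : Function.update x none v = glue v (fun k => x (some k)) := by
    funext o
    cases o with
    | none => simp
    | some k => simp
  rw [hu]
  conv_rhs => rw [hx]
  rw [← mem_sec, ← mem_sec, h v, h (x none)]

/-- A `cyl2`-partner in a mutually A-closed pair is independent of `cyl2` (the `{x_none = 2}` case of TZ″ is vacuous). [this work] -/
theorem indep_cyl2_of_mutAClosed {b : Finset (Pt (Option κ))} (hb : IsUpperSet (b : Set (Pt (Option κ))))
    (hM : MutAClosed b cyl2) : Indep b cyl2 :=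
  indep_cyl2_of_axisInessential (axisInessential_none_of_sec_eq (sec_eq_sec_two_of_cyl2 hb hM.1))

/-- If `b` depends on the axis `none` and `b₀ = b₁`, some point lies in `b₂ ∖ b₁`. [this work] -/
theorem exists_mem_sec_two_not_mem {b : Finset (Pt (Option κ))} (hb : IsUpperSet (b : Set (Pt (Option κ))))
    (hdep : ¬ AxisInessential b none) (h01 : sec b 0 = sec b 1) : ∃ y', y' ∈ sec b 2 ∧ y' ∉ sec b 1 := by
  by_contra hne
  push Not at hne
  have h12 : sec b 1 = sec b 2 := Subset.antisymm (sec_mono hb (by decide)) fun y hy => hne y hy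
  apply hdep
  apply axisInessential_none_of_sec_eq
  intro l
  fin_cases l
  · exact h01.trans h12
  · exact h12
  · rfl

/-- **TZ″ FOR A THRESHOLD-1 CYLINDER PARTNER** (all `κ`, FBP-free): if `b` is an up-set depending on the axis `none`, `(b, {x_none ≥ 1})` is
mutually A-closed, and `a` is a nonempty up-set, then `κ(a, b, {x_none ≥ 1}) ≠ 0` (indeed `> 0`).
PROOF: mutual A-closedness gives `⊤' ∈ b₀` and `b₀ = b₁`, dependence a point `y' ∈ b₂ ∖ b₁`; at a zero `a₂ ∩ b₂ = a₂ ∩ b₁` and `a₂ ⊥ b₁`;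
raising the `b₁`-inessential coordinates of `y'` to `2` gives a point of `a₂ ∩ (b₂ ∖ b₁)` (it agrees with `⊤' ∈ a₂` on the `a₂`-essential axes). [this work] -/
theorem kappa_cyl1_ne_zero_of_mutAClosed {a b : Finset (Pt (Option κ))} (ha : IsUpperSet (a : Set (Pt (Option κ))))
    (hb : IsUpperSet (b : Set (Pt (Option κ)))) (hane : a.Nonempty) (hdep : ¬ AxisInessential b none)
    (hM : MutAClosed b cyl1) : kappa a b cyl1 ≠ 0 := by
  classical
  intro h0
  obtain ⟨E, -, -, -, I⟩ := sections_of_kappa_cyl1_eq_zero ha hb h0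
  have h01 : sec b 0 = sec b 1 := sec_zero_eq_sec_one hb hM.1
  obtain ⟨y', hy2, hy1⟩ := exists_mem_sec_two_not_mem hb hdep h01
  have htop : (fun _ : κ => (2 : Fin 3)) ∈ sec a 2 := by
    rw [mem_sec, glue_two_top]; exact top_mem_of_nonempty ha hane
  set w' : Pt κ := fun k => if AxisInessential (sec b 1) k then 2 else y' k with hw'
  have hyw : y' ≤ w' := fun k => by
    simp only [hw']
    split_ifs
    · exact Fin.le_iff_val_le_val.2 (by have := (y' k).isLt; simp; omega)
    · exact le_rfl
  have hw2 : w' ∈ sec b 2 := isUpperSet_sec hb 2 hyw hy2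
  have hw1 : w' ∉ sec b 1 := by
    intro hw
    apply hy1
    refine (mem_iff_mem_of_agree (s := sec b 1) (x := w') (y := y') fun k => ?_).1 hw
    by_cases hk : AxisInessential (sec b 1) k
    · exact Or.inr hk
    · exact Or.inl (by simp [hw', hk])
  have hwa : w' ∈ sec a 2 := by
    refine (mem_iff_mem_of_agree (s := sec a 2) (x := w') (y := fun _ => (2 : Fin 3)) fun k => ?_).2 htop
    rcases I k with hk | hk
    · exact Or.inr hk
    · exact Or.inl (by simp [hw', hk])
  have : w' ∈ sec a 2 ∩ sec b 1 := by rw [← E]; exact mem_inter.2 ⟨hwa, hw2⟩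
  exact hw1 (mem_inter.1 this).2

/-- Positive form: under the same hypotheses `κ(a, b, {x_none ≥ 1}) > 0`. [this work] -/
theorem kappa_cyl1_pos_of_mutAClosed {a b : Finset (Pt (Option κ))} (ha : IsUpperSet (a : Set (Pt (Option κ))))
    (hb : IsUpperSet (b : Set (Pt (Option κ)))) (hane : a.Nonempty) (hdep : ¬ AxisInessential b none)
    (hM : MutAClosed b cyl1) : 0 < kappa a b cyl1 :=
  lt_of_le_of_ne (kappa_cyl1_nonneg ha hb) (kappa_cyl1_ne_zero_of_mutAClosed ha hb hane hdep hM).symm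
/-- **Conjecture TZ″ holds for every pair with a `{x_none ≥ 1}` partner** (the instance of `MutAClosedZeroFree` with `c = cyl1`). [this work] -/
theorem mutAClosedZeroFree_cyl1 (a b : Finset (Pt (Option κ))) (hup : UpTriple a b cyl1) (ha : a.Nonempty)
    (hM : MutAClosed b cyl1) (hI : ¬ Indep b cyl1) : kappa a b cyl1 ≠ 0 :=
  kappa_cyl1_ne_zero_of_mutAClosed hup.1 hup.2.1 ha (fun h => hI (indep_cyl1_of_axisInessential h)) hM

/-- **Conjecture TZ″ holds (vacuously) for every pair with a `{x_none = 2}` partner.** [this work] -/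
theorem mutAClosedZeroFree_cyl2 (b : Finset (Pt (Option κ))) (hb : IsUpperSet (b : Set (Pt (Option κ))))
    (hM : MutAClosed b cyl2) (hI : ¬ Indep b cyl2) : False :=
  hI (indep_cyl2_of_mutAClosed hb hM)

/-! ## §5  A-closed and terminal zeros with a cylinder member are pairwise independent (TZ′ / TZ for the cylinder-member class) -/

/-- **TZ′ FOR THE CYLINDER-MEMBER CLASS** (all `κ`, FBP-free): an A-closed zero `(a, b, {x_none ≥ 1})` with `a, b` nonempty up-sets is
pairwise independent. [this work] -/
theorem indep_all_of_aclosed_zero_cyl1 {a b : Finset (Pt (Option κ))} (hup : UpTriple a b cyl1) (ha : a.Nonempty)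
    (hA : AClosed a b cyl1) (h0 : kappa a b cyl1 = 0) : Indep a b ∧ Indep a cyl1 ∧ Indep b cyl1 := by
  by_cases hI : Indep b cyl1
  · exact indep_all_of_aclosed_zero_of_indepPair hup hA h0 (Or.inr (Or.inr hI))
  · exact absurd h0 (mutAClosedZeroFree_cyl1 a b hup ha hA.mutAClosed₂₃ hI)

/-- The same with the cylinder in the middle slot. [this work] -/
theorem indep_all_of_aclosed_zero_cyl1₂ {a c : Finset (Pt (Option κ))} (hup : UpTriple a cyl1 c) (ha : a.Nonempty)
    (hA : AClosed a cyl1 c) (h0 : kappa a cyl1 c = 0) : Indep a cyl1 ∧ Indep a c ∧ Indep cyl1 c := by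
  have h0' : kappa a c cyl1 = 0 := by rw [kappa_swap23]; exact h0
  obtain ⟨h1, h2, h3⟩ := indep_all_of_aclosed_zero_cyl1 hup.swap23 ha hA.swap23 h0'
  exact ⟨h2, h1, h3.symm⟩

/-- The same with the cylinder in the first slot. [this work] -/
theorem indep_all_of_aclosed_zero_cyl1₁ {b c : Finset (Pt (Option κ))} (hup : UpTriple cyl1 b c) (hb : b.Nonempty)
    (hA : AClosed cyl1 b c) (h0 : kappa cyl1 b c = 0) : Indep cyl1 b ∧ Indep cyl1 c ∧ Indep b c := by
  have h0' : kappa b cyl1 c = 0 := by rw [kappa_swap12]; exact h0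
  obtain ⟨h1, h2, h3⟩ := indep_all_of_aclosed_zero_cyl1₂ hup.swap12 hb hA.swap12 h0'
  exact ⟨h1.symm, h3, h2⟩

/-- A-closed zeros with a `{x_none = 2}` member are pairwise independent (no nonemptiness needed). [this work] -/
theorem indep_all_of_aclosed_zero_cyl2 {a b : Finset (Pt (Option κ))} (hup : UpTriple a b cyl2)
    (hA : AClosed a b cyl2) (h0 : kappa a b cyl2 = 0) : Indep a b ∧ Indep a cyl2 ∧ Indep b cyl2 :=
  indep_all_of_aclosed_zero_of_indepPair hup hA h0 (Or.inr (Or.inr (indep_cyl2_of_mutAClosed hup.2.1 hA.mutAClosed₂₃)))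

/-- **TZ FOR THE CYLINDER-MEMBER CLASS**: a terminal zero `(a, b, {x_none ≥ 1})` with `a, b` nonempty up-sets is pairwise independent.
[this work] -/
theorem indep_all_of_terminal_zero_cyl1 {a b : Finset (Pt (Option κ))} (hup : UpTriple a b cyl1) (ha : a.Nonempty)
    (hT : Terminal a b cyl1) (h0 : kappa a b cyl1 = 0) : Indep a b ∧ Indep a cyl1 ∧ Indep b cyl1 :=
  indep_all_of_aclosed_zero_cyl1 hup ha hT.aclosed h0

end Summit.CriticalPhenomena.PercolationContinuityZ3.Theorems.SahiLatin
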